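import Summits.KontsevichZagierPeriods.KontsevichZagierPeriods.Theorems.HurwitzMicroSectorsNormalFormPrinciplePiBoxTransfer

/-!
# `NormalFormPrinciple` (stmt-KontsevichZagierPeriods-3869), line `SketchIdeator1` ("π buys geometry") —
# the residual certificate: the crux BY NAME is equivalent to its two leaves

Pure proof file (lead seat c2). With the transfer theorem of the line
(`statement_iff_leaves`, `normalFormPrinciple_of_leaves`, `piLocalKernel_of_boxRigidity`,
`boxVanishing_of_boxRigidity` / `boxRigidity_of_boxVanishing`, all in
`Theorems/HurwitzMicroSectorsNormalFormPrinciplePiBoxTransfer.lean`) and the route's deciding theorem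
`closes : NormalFormPrinciple → KontsevichZagierPeriods`, the crux itself — not only the Statement — is
kernel-checked EQUIVALENT to each of three residual pairs:

* `normalFormPrinciple_iff_leaves` : `NormalFormPrinciple ↔ BoxRigidity ∧ KZ.PiCancellation`
  (BoxRigidity inlined: two box-rational representations with equal values are KZ-equivalent);
* `normalFormPrinciple_iff_boxVanishing_and_piCancellation` : the same with the ONE-representation
  form BoxVanishing (a box-rational representation of value `0` is a relation);
* `normalFormPrinciple_iff_piLocalKernel_and_piCancellation` :
  `NormalFormPrinciple ↔ KZ.PiLocalKernel ∧ KZ.PiCancellation` — the conjunction of the two EXISTING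
  items stmt-KontsevichZagierPeriods-0541 and stmt-KontsevichZagierPeriods-0540 of route
  AyoubSpecialisation (→ : BoxRigidity gives `PiLocalKernel` through the unconditional
  PiBoxReduction; ← : peel the power of `[π]` with PiCancellation, kernel form of Conjecture 1).

So the line's registered stubs `stub_boxRigidity`, `stub_piCancellation` are JOINTLY exactly
crux-strength (= summit-strength), and `stub_boxRigidity` alone sits between the summit and item 0541.
Source: M. Kontsevich, D. Zagier, *Periods* (2001), §1.2 Conjecture 1, §4.1; J. Ayoub, EMS Newsl. 91
(2014), Def. 6 / Conj. 7 (the localisation at `2πi`).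
-/

noncomputable section

open MeasureTheory Set
open Literature.NumberTheory.Transcendental Literature.NumberTheory.Transcendental.KZ

namespace Summit.KontsevichZagierPeriods.HurwitzMicroSectors.NormalFormPrinciple.PiBox

open Summit.KontsevichZagierPeriods.KontsevichZagierPeriods.Theses.HurwitzMicroSectors
  (NormalFormPrinciple closes)

/-- **Residual certificate, two-representation form.** The crux `NormalFormPrinciple` holds if and
only if BoxRigidity (two representations on open unit boxes with integrands of KZ's rational
shape and equal values are KZ-equivalent) and `KZ.PiCancellation` both hold: `→` by the route's
deciding theorem `closes` and `leaves_of_statement`; `←` is `normalFormPrinciple_of_leaves`.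
[cite: KontsevichZagier2001, §1.2 Conjecture 1] -/
theorem normalFormPrinciple_iff_leaves :
    NormalFormPrinciple ↔
      ((∀ (m m' : ℕ) (N : IntegralRep m) (N' : IntegralRep m'),
        N.domain = {x | ∀ i, x i ∈ Set.Ioo (0:ℝ) 1} → N.IsRational →
        N'.domain = {x | ∀ i, x i ∈ Set.Ioo (0:ℝ) 1} → N'.IsRational →
        N.value = N'.value → Equivalent N N') ∧ PiCancellation) :=
  ⟨fun h => leaves_of_statement (closes h), fun h => normalFormPrinciple_of_leaves h.1 h.2⟩

/-- **Residual certificate, one-representation form.** The crux `NormalFormPrinciple` holds if and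
only if BoxVanishing (a representation on an open unit box with integrand of KZ's rational shape
and value `0` lies in `KZ.relations`) and `KZ.PiCancellation` both hold
(`boxVanishing_of_boxRigidity`, `boxRigidity_of_boxVanishing`). [cite: KontsevichZagier2001, §1.2 Conjecture 1] -/
theorem normalFormPrinciple_iff_boxVanishing_and_piCancellation :
    NormalFormPrinciple ↔
      ((∀ (m : ℕ) (N : IntegralRep m), N.domain = {x | ∀ i, x i ∈ Set.Ioo (0:ℝ) 1} →
        N.IsRational → N.value = 0 → of N ∈ relations) ∧ PiCancellation) := by
  rw [normalFormPrinciple_iff_leaves]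
  exact and_congr_left fun _ =>
    ⟨fun h m N hd hr hv => boxVanishing_of_boxRigidity h N hd hr hv,
      fun h => boxRigidity_of_boxVanishing h⟩

/-- **Residual certificate, `π`-localised form.** The crux `NormalFormPrinciple` holds if and only
if `KZ.PiLocalKernel` (item stmt-KontsevichZagierPeriods-0541: every formal combination of value `0`
becomes a relation after multiplying by a power of `[π]`) and `KZ.PiCancellation` (item
stmt-KontsevichZagierPeriods-0540) both hold. `→`: BoxRigidity (from the crux) gives `PiLocalKernel`
by `piLocalKernel_of_boxRigidity` (the unconditional PiBoxReduction of the line); `←`: a formal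
combination of value `0` has `[π]^N·c ∈ relations`, PiCancellation peels the power
(`mem_of_piPow_mem`), so `ker eval = relations`, which is Conjecture 1 in KZ's literal form
(`kzKernelConjecture_iff_isRational`) and hence the crux (`normalFormPrinciple_of_statement`).
[cite: Ayoub2014, Def. 6 and Conj. 7] -/
theorem normalFormPrinciple_iff_piLocalKernel_and_piCancellation :
    Summit.KontsevichZagierPeriods.KontsevichZagierPeriods.Theses.HurwitzMicroSectors.NormalFormPrinciple ↔ (Literature.NumberTheory.Transcendental.KZ.PiLocalKernel ∧ Literature.NumberTheory.Transcendental.KZ.PiCancellation) := by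
  constructor
  · intro h
    obtain ⟨hrig, hpc⟩ := normalFormPrinciple_iff_leaves.mp h
    exact ⟨piLocalKernel_of_boxRigidity hrig, hpc⟩
  · rintro ⟨hloc, hpc⟩
    have hker : KZKernelConjecture := fun c hc => by
      obtain ⟨N, hN⟩ := hloc c hc
      exact mem_of_piPow_mem hpc N hN
    exact normalFormPrinciple_of_statement
      ((KontsevichZagierPeriods_iff).mpr (kzKernelConjecture_iff_isRational.mp hker))

end Summit.KontsevichZagierPeriods.HurwitzMicroSectors.NormalFormPrinciple.PiBox
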